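import Mathlib

/-!
# The σ-Hermitian lift: tangency sets from any commutative ring with involution
(wall-breaker axis `Hermitian unital constructions`, stub `stub_tangencySets` of the crux `LevelOneGL2Designs`,
stmt-MatrixMultiplication-14080, k7 — file 1: the algebraic core)

The Hermitian unital of `AG(2,q²)` is `U = {(x,y) : y + yᵠ = 2·x·xᵠ}` (`ᵠ` = Frobenius of `𝔽_{q²}/𝔽_q`, a RING
INVOLUTION), and the tangent to `U` at `(x',y')` is the line `Y − y' = 2·x'ᵠ·(X − x')`; it meets `U` only at `(x',y')`
because along it the "height" `h = Y + Yᵠ − 2XXᵠ` drops by the NORM `2·N(X − x')`, which vanishes only at `X = x'`.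
This file isolates that mechanism over an ARBITRARY commutative ring `O` with a ring involution `σ`
(`height_sub_height_of_incident`): if `(x,y)` lies on the line of `(x',y')`, i.e.
`F := 2(x − x')·σx' − (y − y') = 0`, then `h(x',y') − h(x,y) = 2·(x − x')·σ(x − x')` with `h(x,y) = y + σy − 2x·σx`.
Consequently (`tangencySet_of_hermitianLift`), for a ring map `g : O → ZMod p` and a finite `V ⊆ O × O` such that
(i) `g` detects `F = 0` on `V` ("no wrap-around") and (ii) on `V` the height difference is never a non-trivial
`2·N(x − x')` ("norm-difference-freeness"), the points `(g x, g y)` with the lines of normal `(2·g(σx'), −1)` form an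
affine tangency set of `AG(2,p)` with exactly `|V|` points; `tangencySet_of_hermitianLift_graph` is the version for
`V = {(x, x·σx + u) : x ∈ X, u ∈ U}` (heights `u + σu`), of size `|X|·|U|`.

Specialisations: `σ = Frobenius`, `O = 𝔽_{q²}`, `g = id` is the classical unital (`…StubTangencySetsHermitian`, k10);
`σ = id` is the PARABOLA `y = x² + u` with its tangents — Pohoata's number-field parabola lift
(`…TraceLiftTangency.tangencySet_of_lift`, k11) is the case `σ = id`, `O` = integers of a totally real field, `U` trace-zero;
`σ` = complex conjugation on the integers of a CM field, `U` trace-zero, is the new CM-Hermitian lift of the companion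
files (`…HermitianLiftCM`, `…HermitianLiftCyclotomic`), which reaches `p^{3/2 − 1/[K:ℚ]}` over PRIME fields.
Elementary; no definitions.
-/

-- the summit/problem path `MatrixMultiplication.MatrixMultiplication` is fixed by the tree layout (D-0017)
set_option linter.dupNamespace false

noncomputable section

open Finset Matrix

namespace Summit.MatrixMultiplication.MatrixMultiplication.Theorems.LevelOneGL2Designs.HermitianLift

/-- **The tangency identity of the unital, over any commutative ring with involution.**  Let `σ : O → O` be a ring
involution.  If `(x,y)` lies on the "tangent line of `(x',y')`", i.e. `2(x − x')·σx' − (y − y') = 0`, then the heights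
`h(x,y) = y + σy − 2·x·σx` satisfy `h(x',y') − h(x,y) = 2·(x − x')·σ(x − x')`: apply `σ` to the incidence and add.
[folklore: the computation behind "a tangent of the Hermitian curve meets it once"] -/
theorem height_sub_height_of_incident {O : Type*} [CommRing O] (σ : O →+* O) (hσ : ∀ z, σ (σ z) = z)
    {x y x' y' : O}
    (h : 2 * (x - x') * σ x' - (y - y') = 0) :
    (y' + σ y' - 2 * (x' * σ x')) - (y + σ y - 2 * (x * σ x)) = 2 * ((x - x') * σ (x - x')) := by
  have h' := congrArg σ h
  simp only [map_sub, map_mul, map_ofNat, hσ, map_zero] at h'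
  rw [map_sub]
  linear_combination h + h'

/-- **The σ-Hermitian lift.**  `O` a commutative ring with a ring involution `σ`, `g : O → ZMod p` a ring map, `V ⊆ O × O`
finite.  Assume (i) *no wrap-around*: for `P, P' ∈ V`, `g(2(x − x')σx' − (y − y')) = 0` forces
`2(x − x')σx' − (y − y') = 0` in `O`; (ii) *norm-difference-freeness of heights*: for `P, P' ∈ V`,
`h(P') − h(P) = 2(x − x')σ(x − x')` forces `x = x'` (`h(x,y) = y + σy − 2xσx`).  Then the points `(g x, g y)`, `(x,y) ∈ V`,
are `|V|` distinct points of `AG(2,p)`, and the line through `(g x', g y')` with normal `(2·g(σx'), −1)` meets them only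
there.  (Unital: `σ` = Frobenius; parabola: `σ = id`; CM lift: `σ` = complex conjugation.) [elementary] -/
theorem tangencySet_of_hermitianLift {O : Type*} [CommRing O] {p : ℕ} [Fact p.Prime]
    (σ : O →+* O) (hσ : ∀ z, σ (σ z) = z) (g : O →+* ZMod p) (V : Finset (O × O))
    (h1 : ∀ P ∈ V, ∀ P' ∈ V, g (2 * (P.1 - P'.1) * σ P'.1 - (P.2 - P'.2)) = 0 →
      2 * (P.1 - P'.1) * σ P'.1 - (P.2 - P'.2) = 0)
    (h2 : ∀ P ∈ V, ∀ P' ∈ V,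
      (P'.2 + σ P'.2 - 2 * (P'.1 * σ P'.1)) - (P.2 + σ P.2 - 2 * (P.1 * σ P.1)) =
        2 * ((P.1 - P'.1) * σ (P.1 - P'.1)) → P.1 = P'.1) :
    ∃ W : Finset (Fin 2 → ZMod p), W.card = V.card ∧
      ∀ v ∈ W, ∃ u : Fin 2 → ZMod p, u ≠ 0 ∧ ∀ w ∈ W, u ⬝ᵥ w = u ⬝ᵥ v → w = v := by
  classical
  -- the key: `g F(P,P') = 0` only for `P = P'`
  have key : ∀ P ∈ V, ∀ P' ∈ V, g (2 * (P.1 - P'.1) * σ P'.1 - (P.2 - P'.2)) = 0 → P = P' := by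
    intro P hP P' hP' h
    have hF := h1 P hP P' hP' h
    have hx := h2 P hP P' hP' (height_sub_height_of_incident σ hσ hF)
    have hy : P.2 = P'.2 := by
      rw [hx, sub_self, mul_zero, zero_mul, zero_sub, neg_eq_zero, sub_eq_zero] at hF
      exact hF
    exact Prod.ext hx hy
  let pt : O × O → (Fin 2 → ZMod p) := fun P => ![g P.1, g P.2]
  have hinj : Set.InjOn pt ↑V := by
    intro P hP P' hP' h
    have hx : g P.1 = g P'.1 := by simpa [pt] using congr_fun h 0
    have hy : g P.2 = g P'.2 := by simpa [pt] using congr_fun h 1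
    refine key P hP P' hP' ?_
    simp only [map_sub, map_mul, map_ofNat, hx, hy]
    ring
  refine ⟨V.image pt, card_image_of_injOn hinj, ?_⟩
  simp only [mem_image]
  rintro _ ⟨P', hP', rfl⟩
  refine ⟨![2 * g (σ P'.1), -1], fun h => by simpa using congr_fun h 1, ?_⟩
  rintro _ ⟨P, hP, rfl⟩ h
  simp only [pt, vec2_dotProduct, Matrix.cons_val_zero, Matrix.cons_val_one] at h
  have h0 : g (2 * (P.1 - P'.1) * σ P'.1 - (P.2 - P'.2)) = 0 := by
    simp only [map_sub, map_mul, map_ofNat]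
    linear_combination h
  rw [key P hP P' hP' h0]

/-- **The σ-Hermitian lift, graph form.**  With `V = {(x, x·σx + u) : x ∈ X, u ∈ U}` the height of `(x, x·σx + u)` is
`u + σu`, so: if `g` detects `2(x − x')σx' − ((xσx + u) − (x'σx' + u')) = 0` on `X, U` and `(u' + σu') − (u + σu)` is never
a non-trivial `2(x − x')σ(x − x')`, then `AG(2,p)` has an affine tangency set with exactly `|X|·|U|` points (the map
`(x,u) ↦ (x, xσx + u)` being injective).  For `σ = id` this is the parabola family `y = x² + u`. [elementary] -/
theorem tangencySet_of_hermitianLift_graph {O : Type*} [CommRing O] {p : ℕ} [Fact p.Prime]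
    (σ : O →+* O) (hσ : ∀ z, σ (σ z) = z) (g : O →+* ZMod p) (X U : Finset O)
    (h1 : ∀ x ∈ X, ∀ x' ∈ X, ∀ u ∈ U, ∀ u' ∈ U,
      g (2 * (x - x') * σ x' - ((x * σ x + u) - (x' * σ x' + u'))) = 0 →
      2 * (x - x') * σ x' - ((x * σ x + u) - (x' * σ x' + u')) = 0)
    (h2 : ∀ x ∈ X, ∀ x' ∈ X, ∀ u ∈ U, ∀ u' ∈ U,
      (u' + σ u') - (u + σ u) = 2 * ((x - x') * σ (x - x')) → x = x') :
    ∃ W : Finset (Fin 2 → ZMod p), W.card = X.card * U.card ∧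
      ∀ v ∈ W, ∃ u : Fin 2 → ZMod p, u ≠ 0 ∧ ∀ w ∈ W, u ⬝ᵥ w = u ⬝ᵥ v → w = v := by
  classical
  let gr : O × O → O × O := fun q => (q.1, q.1 * σ q.1 + q.2)
  have hgr : Function.Injective gr := by
    rintro ⟨x, u⟩ ⟨x', u'⟩ h
    have hx : x = x' := congrArg Prod.fst h
    have hy : x * σ x + u = x' * σ x' + u' := congrArg Prod.snd h
    subst hx
    exact Prod.ext rfl (add_left_cancel hy)
  set V : Finset (O × O) := (X ×ˢ U).image gr with hV
  have hheight : ∀ x u : O, (x * σ x + u) + σ (x * σ x + u) - 2 * (x * σ x) = u + σ u := by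
    intro x u
    simp only [map_add, map_mul, hσ]
    ring
  have h1' : ∀ P ∈ V, ∀ P' ∈ V, g (2 * (P.1 - P'.1) * σ P'.1 - (P.2 - P'.2)) = 0 →
      2 * (P.1 - P'.1) * σ P'.1 - (P.2 - P'.2) = 0 := by
    simp only [hV, mem_image, mem_product]
    rintro _ ⟨⟨x, u⟩, ⟨hx, hu⟩, rfl⟩ _ ⟨⟨x', u'⟩, ⟨hx', hu'⟩, rfl⟩ h
    exact h1 x hx x' hx' u hu u' hu' h
  have h2' : ∀ P ∈ V, ∀ P' ∈ V,
      (P'.2 + σ P'.2 - 2 * (P'.1 * σ P'.1)) - (P.2 + σ P.2 - 2 * (P.1 * σ P.1)) =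
        2 * ((P.1 - P'.1) * σ (P.1 - P'.1)) → P.1 = P'.1 := by
    simp only [hV, mem_image, mem_product]
    rintro _ ⟨⟨x, u⟩, ⟨hx, hu⟩, rfl⟩ _ ⟨⟨x', u'⟩, ⟨hx', hu'⟩, rfl⟩ h
    refine h2 x hx x' hx' u hu u' hu' ?_
    rw [← h, hheight, hheight]
  obtain ⟨W, hW, htan⟩ := tangencySet_of_hermitianLift σ hσ g V h1' h2'
  refine ⟨W, ?_, htan⟩
  rw [hW, hV, card_image_of_injective _ hgr, card_product]

end Summit.MatrixMultiplication.MatrixMultiplication.Theorems.LevelOneGL2Designs.HermitianLift
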